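import Summits.QuantumAdvantage.QuantumAdvantage.Theorems.WhiteBoxWalkWbwObfuscatedGluedTrees
import Literature.Computability.Cryptography.ObfuscatedGluedTrees

/-!
# `WbwObfuscatedGluedTrees` (stmt-QuantumAdvantage-2340) — line `knowledge-of-walk-split`, STAGE 2: vocabulary of the
# instantiation on the landed generator `obfuscatedGluedTreesGen`

Definitions file (no theorem content beyond unfolding lemmas; no hardness asserted) for stage 2 of the line
`knowledge-of-walk-split` of the INFORMAL crux `WbwObfuscatedGluedTrees` (route `Theses/WhiteBoxWalk`; lead
prover-line-stmt-QuantumAdvantage-2340-1).  Stage 1 is closed: `KnowledgeOfWalkSplit.knowledgeTransfer_holds`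
(`Theorems/WhiteBoxWalkWbwObfuscatedGluedTrees.lean`) proves, for every KEY-INDEXED line datum `𝓛 : LineData`
admissible for a sub-exp iO `O`, `Coherent → KnowledgeOfWalk 𝓛.M 𝓛.gen₀ → WordHard 𝓛.M 𝓛.gen₀ 𝓛.answer →
ClauseC (𝓛.gen O) 𝓛.answer`.  Stage 2 instantiates it on the generator that has since LANDED,
`Literature.Computability.Cryptography.obfuscatedGluedTreesGen Λ O P f c = (gen Λ O P, ans Λ O P)`
(`ObfuscatedGluedTrees.lean`), whose data are indexed by the seed LENGTH `n` and the key material `K`, not by a key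
alone.  The bridge is this file's vocabulary:

* §1 `evalModel` — the EVALUATING walk model of instance strings `⟨code, e⟩` (entrance `e`, name length `|e|`,
  neighbour listing = decode the sized circuit from `code`, evaluate it bitwise on `(name, position)`, read the
  answer back with the generator's own `decodeAnswer`; `none` on strings it lists no neighbour for).  This is the
  model in which KWA₀ / WordHard₀ mean white-box extractability / path-finding hardness (Disproof §7 (M): the walk
  model must be `M_eval` by construction, not free data).
* §2 `MasterData` — MASTER-PARAMETRISED schedules: every schedule of the parameter record is a function of the
  key-part length `ℓ = keyPartLen n` (`D.params : Params`), so that the key `k = s.take (4ℓ)` handed to the line's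
  key-indexed families recovers its level as `ℓ = |k| / 4`; `D.lineData Γ₁ P : LineData` is the line datum of
  stage 1 for a REFERENCE presentation `Γ₁` (same arity as the shipped presentation `D.Γ`; intended: a padded
  obfuscation of the neighbour circuit by ONE fixed reference obfuscator, its coins derived from the key), with
  `C₀ = D.Γ`, `C₁ = Γ₁`, entrance/EXIT names of the generator, and `M = evalModel`.
* §3 `GenAdmissible D Γ₁ O P` — the DEFINITIONAL side conditions (schedules unary-poly-time / polynomially
  sandwiched, `4ℓ ≤ n`, polynomial code length, both presentations in `ppolyCircuits κ`, equal size and function,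
  the shipped presentation computes the neighbour predicate, and — eventually in `n` — the obfuscator's coin demand
  is the coin schedule and fits in the seed after the keys).  No hardness content.

[folklore] modelling conventions of the route; objects: ChildsEtAl2003 §2 (names, oracle), BitanskyPanethRosen2015
§5.2 (keys + obfuscated program as the instance).
-/

set_option linter.dupNamespace false

noncomputable section

namespace Summit.QuantumAdvantage.QuantumAdvantage.Theorems.WbwObfuscatedGluedTrees.KnowledgeOfWalk.Generator

open Literature.Computability.Cryptography Literature.Computability.Complexity Filter Asymptotics
open Literature.Computability.Cryptography.ObfuscatedGluedTrees
open Literature.Computability.QuantumComplexity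
open Summit.QuantumAdvantage.QuantumAdvantage.Theorems.WbwObfuscatedGluedTrees.KnowledgeOfWalk
  (WalkModel genObf genClear keyed KnowledgeOfWalk WordHard)

/-! ## §1 The evaluating walk model -/

open Classical in
/-- Decode a sized circuit from its Boolean code (`none` if the string is not a code; specification-level
inverse of the injective `encodeSizedCircuit`). [folklore] -/
def decodeSC (c : List Bool) : Option SizedCircuit :=
  if h : ∃ C : SizedCircuit, encodeSizedCircuit C = c then some h.choose else none

/-- `decodeSC` inverts `encodeSizedCircuit`. [folklore] -/
@[simp] theorem decodeSC_encodeSizedCircuit (C : SizedCircuit) : decodeSC (encodeSizedCircuit C) = some C := by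
  classical
  unfold decodeSC
  have h : ∃ C' : SizedCircuit, encodeSizedCircuit C' = encodeSizedCircuit C := ⟨C, rfl⟩
  rw [dif_pos h, Option.some.injEq]
  exact encodeSizedCircuit_injective h.choose_spec

/-- A string read as a bit vector of length `N` (missing bits `false`). [folklore] -/
def vecOf (N : ℕ) (y : List Bool) : Fin N → Bool := fun i => y.getD i false

/-- The query input of the neighbour circuit: the name `y` on the first `N` wires, the output position `t` in
binary on the last `N` wires (wires beyond `2N`, if the circuit has more, read `false`). [folklore] -/
def queryInput (N m : ℕ) (y : List Bool) (t : ℕ) : Fin m → Bool := fun i =>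
  if h : (i : ℕ) < N + N then Fin.append (vecOf N y) (GluedTrees.nameOfVal N t) ⟨i, h⟩ else false

/-- The answer string of the sized circuit `C` on the name `y`: its output bits at the positions
`t < ansLen N` (`2`-bit neighbour count, then three name slots). [folklore] -/
def answerOf (N : ℕ) (C : SizedCircuit) (y : List Bool) : List Bool :=
  List.ofFn fun t : Fin (ansLen N) => C.2.eval (queryInput N C.1 y t)

/-- A neighbour listing as an optional value: `none` for the empty listing (the string named no vertex),
the listing itself otherwise. [folklore] -/
def listing : List (List Bool) → Option (List (List Bool))
  | [] => none
  | l :: L => some (l :: L)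

/-- `listing [] = none`. [folklore] -/
@[simp] theorem listing_nil : listing [] = none := rfl

/-- `listing (l :: L) = some (l :: L)`. [folklore] -/
@[simp] theorem listing_cons (l : List Bool) (L : List (List Bool)) : listing (l :: L) = some (l :: L) := rfl

/-- `listing L` is a value iff `L` is nonempty. [folklore] -/
theorem isSome_listing_iff (L : List (List Bool)) : (listing L).isSome = true ↔ L ≠ [] := by
  cases L <;> simp

/-- The names listed in an answer string, as strings (the generator's `decodeAnswer`, then `List.ofFn`).
[folklore] -/
def namesOf (N : ℕ) (w : List Bool) : List (List Bool) := (decodeAnswer N w).map List.ofFn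

/-- The neighbour listing of the instance `x = ⟨code, e⟩` on the string `y`: decode the circuit, evaluate its
answer string on `y`, read the list of names back (`namesOf`); `none` unless the code decodes to a circuit on
`2|e|` wires, `|y| = |e|`, and at least one neighbour is listed. [folklore] -/
def evalNbrs (x y : List Bool) : Option (List (List Bool)) :=
  match decodeSC (boolUnpair x).1 with
  | none => none
  | some C =>
    if C.1 = (boolUnpair x).2.length + (boolUnpair x).2.length ∧ y.length = (boolUnpair x).2.length then
      listing (namesOf (boolUnpair x).2.length (answerOf (boolUnpair x).2.length C y))
    else none

/-- **The evaluating walk model**: entrance = the name shipped in the instance, name length = its length,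
neighbour listing = evaluate the shipped circuit (`evalNbrs`). [folklore] -/
def evalModel : WalkModel where
  entrance x := (boolUnpair x).2
  nameLen x := (boolUnpair x).2.length
  nbrs := evalNbrs

/-! ## §2 Master-parametrised schedules and the line datum of the landed generator -/

/-- **Master data**: the schedules of a parameter record written as functions of the key-part length
`ℓ = t n` (depth `δ ℓ > 0`, PRF parameter `π ℓ`, obfuscator parameter `ς ℓ`), the coin schedule `c n`, and the
circuit PRESENTATION `Γ ℓ K` of the neighbour predicate on `2N` wires, `N = nameLen (π ℓ) (δ ℓ)`. [folklore] -/
structure MasterData where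
  /-- key-part length at seed length `n` (the master parameter `ℓ`) -/
  t : ℕ → ℕ
  /-- tree depth at master parameter `ℓ` -/
  δ : ℕ → ℕ
  /-- the depth is positive -/
  δ_pos : ∀ ℓ, 0 < δ ℓ
  /-- PRF security parameter at master parameter `ℓ` -/
  π : ℕ → ℕ
  /-- obfuscator security parameter at master parameter `ℓ` -/
  ς : ℕ → ℕ
  /-- number of seed bits handed to the obfuscator as coins, at seed length `n` -/
  c : ℕ → ℕ
  /-- circuit presentation of the neighbour predicate for key material `K` at master parameter `ℓ` -/
  Γ : (ℓ : ℕ) → List Bool → Circuit (Fin (nameLen (π ℓ) (δ ℓ) + nameLen (π ℓ) (δ ℓ)))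

namespace MasterData

variable (D : MasterData)

/-- The name length `N = π ℓ + (2 δ ℓ + 3)` at master parameter `ℓ`. [folklore] -/
abbrev Nℓ (ℓ : ℕ) : ℕ := nameLen (D.π ℓ) (D.δ ℓ)

/-- The type of circuit presentations over the master data (the shipped `D.Γ` and any reference `Γ₁`).
[folklore] -/
abbrev Presentation : Type := (ℓ : ℕ) → List Bool → Circuit (Fin (D.Nℓ ℓ + D.Nℓ ℓ))

/-- The parameter record of the landed generator determined by the master data. [folklore] -/
def params : Params where
  depth n := D.δ (D.t n)
  depth_pos n := D.δ_pos (D.t n)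
  prfParam n := D.π (D.t n)
  keyPartLen n := D.t n
  secParam n := D.ς (D.t n)
  coinLen n := D.c n
  circ n K := D.Γ (D.t n) K

/-- The `i`-th key (`i < 4`) cut out of key material `K` at master parameter `ℓ`. [folklore] -/
def keyℓ (ℓ : ℕ) (K : List Bool) (i : ℕ) : List Bool := (K.drop (i * ℓ)).take ℓ

/-- `name_K(ENTRANCE)` at master parameter `ℓ`. [folklore] -/
def entranceNameℓ (P : PuncturablePRFScheme) (ℓ : ℕ) (K : List Bool) : List Bool :=
  vname P (D.π ℓ) (keyℓ ℓ K 0) (keyℓ ℓ K 1) (D.δ ℓ) (GluedTrees.entrance _)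

/-- `name_K(EXIT)` at master parameter `ℓ`. [folklore] -/
def exitNameℓ (P : PuncturablePRFScheme) (ℓ : ℕ) (K : List Bool) : List Bool :=
  vname P (D.π ℓ) (keyℓ ℓ K 0) (keyℓ ℓ K 1) (D.δ ℓ) (GluedTrees.exit _)

/-- **The line datum of the landed generator** for a reference presentation `Γ₁`: security parameter
`κ n = ς (t n)`, key length `h n = 4 t n`, and — reading the level off the key as `ℓ = |k| / 4` — arity `2 N ℓ`,
`C₀ k = Γ ℓ k` (shipped presentation), `C₁ k = Γ₁ ℓ k` (reference presentation), entrance / EXIT names, and the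
evaluating walk model. [folklore] -/
def lineData (Γ₁ : D.Presentation) (P : PuncturablePRFScheme) :
    Summit.QuantumAdvantage.QuantumAdvantage.Cruxes.WbwObfuscatedGluedTrees.KnowledgeOfWalkSplit.LineData where
  κ n := D.ς (D.t n)
  h n := 4 * D.t n
  m k := D.Nℓ (k.length / 4) + D.Nℓ (k.length / 4)
  C₀ k := D.Γ (k.length / 4) k
  C₁ k := Γ₁ (k.length / 4) k
  nm k := D.entranceNameℓ P (k.length / 4) k
  ans k := D.exitNameℓ P (k.length / 4) k
  M := evalModel

/-! ### Unfolding lemmas (all `rfl`) -/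

/-- Unfolding: the depth schedule of `D.params`. [folklore] -/
@[simp] theorem params_depth (n : ℕ) : D.params.depth n = D.δ (D.t n) := rfl
/-- Unfolding: the PRF-parameter schedule of `D.params`. [folklore] -/
@[simp] theorem params_prfParam (n : ℕ) : D.params.prfParam n = D.π (D.t n) := rfl
/-- Unfolding: the key-part length of `D.params` is the master parameter. [folklore] -/
@[simp] theorem params_keyPartLen (n : ℕ) : D.params.keyPartLen n = D.t n := rfl
/-- Unfolding: the obfuscator-parameter schedule of `D.params`. [folklore] -/
@[simp] theorem params_secParam (n : ℕ) : D.params.secParam n = D.ς (D.t n) := rfl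
/-- Unfolding: the coin schedule of `D.params`. [folklore] -/
@[simp] theorem params_coinLen (n : ℕ) : D.params.coinLen n = D.c n := rfl
/-- Unfolding: the circuit presentation of `D.params`. [folklore] -/
theorem params_circ (n : ℕ) (K : List Bool) : D.params.circ n K = D.Γ (D.t n) K := rfl
/-- Unfolding: the name length of `D.params` at seed length `n` is `Nℓ (t n)`. [folklore] -/
theorem params_N (n : ℕ) : D.params.N n = D.Nℓ (D.t n) := rfl
/-- Unfolding: the keys of `D.params` are cut at master parameter `t n`. [folklore] -/
theorem params_key (n : ℕ) (K : List Bool) (i : ℕ) : D.params.key n K i = keyℓ (D.t n) K i := rfl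
/-- Unfolding: `name(ENTRANCE)` of `D.params`. [folklore] -/
theorem params_entranceName (P : PuncturablePRFScheme) (n : ℕ) (K : List Bool) :
    D.params.entranceName P n K = D.entranceNameℓ P (D.t n) K := rfl
/-- Unfolding: `name(EXIT)` of `D.params`. [folklore] -/
theorem params_exitName (P : PuncturablePRFScheme) (n : ℕ) (K : List Bool) :
    D.params.exitName P n K = D.exitNameℓ P (D.t n) K := rfl
/-- Unfolding: the key material of `D.params` is the first `4 t n` seed bits. [folklore] -/
theorem params_keyMaterial (s : List Bool) : D.params.keyMaterial s = s.take (4 * D.t s.length) := rfl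
/-- Unfolding: the walk model of the line datum is `evalModel`. [folklore] -/
theorem lineData_M (Γ₁ : D.Presentation) (P : PuncturablePRFScheme) : (D.lineData Γ₁ P).M = evalModel := rfl
/-- Unfolding: the reference generator of the line datum (`genClear` of the reference presentation). [folklore] -/
theorem lineData_gen₀ (Γ₁ : D.Presentation) (P : PuncturablePRFScheme) :
    (D.lineData Γ₁ P).gen₀ = genClear (fun n => 4 * D.t n) (fun k => D.Nℓ (k.length / 4) + D.Nℓ (k.length / 4))
      (fun k => Γ₁ (k.length / 4) k) (fun k => D.entranceNameℓ P (k.length / 4) k) := rfl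
/-- Unfolding: the crux-shaped generator of the line datum (`genObf` of the shipped presentation). [folklore] -/
theorem lineData_gen (Γ₁ : D.Presentation) (P : PuncturablePRFScheme) (O : CircuitObfuscator) :
    (D.lineData Γ₁ P).gen O = genObf O (fun n => D.ς (D.t n)) (fun n => 4 * D.t n)
      (fun k => D.Nℓ (k.length / 4) + D.Nℓ (k.length / 4))
      (fun k => D.Γ (k.length / 4) k) (fun k => D.entranceNameℓ P (k.length / 4) k) := rfl
/-- Unfolding: the keyed answer of the line datum is `name(EXIT)` read off the key. [folklore] -/
theorem lineData_answer (Γ₁ : D.Presentation) (P : PuncturablePRFScheme) :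
    (D.lineData Γ₁ P).answer = keyed (fun n => 4 * D.t n) (fun k => D.exitNameℓ P (k.length / 4) k) := rfl

end MasterData

/-! ## §3 Definitional admissibility of master data; the residual hypothesis on a reference presentation -/

/-- **`GenAdmissible D O P`** — the definitional side conditions on the master data for the obfuscator `O` and the
PRF scheme `P`, under which the landed generator with parameters `D.params` factors (eventually in the seed length)
through the line datum of stage 1: (1) `n ↦ ς (t n)` is unary-poly-time; (2) `n^c ≤ ς (t n)` eventually;
(3) `ς (t n) ≤ poly(n)`; (4) `4 t n ≤ n`; (5) the code of the shipped presentation has length polynomial in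
`ℓ + |K|`; (6) at every level it lies in `ppolyCircuits (ς ℓ)`; (7) it computes the neighbour predicate `N_K`
(SIV names from keys `0,1`, Feistel cycle from keys `2,3` — the generator's `CircCorrect`); (8) eventually in `n`,
for every key material of length `4 t n`, the obfuscator's coin demand on it fits in the seed after the keys and IS
the coin schedule `c n`. No hardness content. [folklore] -/
def GenAdmissible (D : MasterData) (O : CircuitObfuscator) (P : PuncturablePRFScheme) : Prop :=
  PolyTimeComputable Computability.unaryEncodeNat Computability.unaryEncodeNat (fun n => D.ς (D.t n)) ∧
  (∃ c : ℝ, 0 < c ∧ ∀ᶠ n : ℕ in atTop, (n : ℝ) ^ c ≤ D.ς (D.t n)) ∧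
  (∃ p : Polynomial ℕ, ∀ n, D.ς (D.t n) ≤ p.eval n) ∧
  (∀ n, 4 * D.t n ≤ n) ∧
  (∃ q : Polynomial ℕ, ∀ ℓ K, (encodeSizedCircuit ⟨_, D.Γ ℓ K⟩).length ≤ q.eval (ℓ + K.length)) ∧
  (∀ ℓ K, (⟨_, D.Γ ℓ K⟩ : SizedCircuit) ∈ ppolyCircuits (D.ς ℓ)) ∧
  (∀ ℓ K x, (D.Γ ℓ K).eval x =
      nbrBit (cycleOf P (D.π ℓ) (MasterData.keyℓ ℓ K 2) (MasterData.keyℓ ℓ K 3) (D.δ ℓ))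
        (naming P (D.π ℓ) (MasterData.keyℓ ℓ K 0) (MasterData.keyℓ ℓ K 1) (D.δ ℓ)) x) ∧
  (∃ n₀ : ℕ, ∀ n, n₀ ≤ n → ∀ K : List Bool, K.length = 4 * D.t n →
      O.coins (D.ς (D.t n)) (D.Γ (D.t n) K) + 4 * D.t n ≤ n ∧
      D.c n = O.coins (D.ς (D.t n)) (D.Γ (D.t n) K))

/-- Clause (7) of `GenAdmissible` is the generator's `CircCorrect` for `D.params`. [folklore] -/
theorem GenAdmissible.circCorrect {D : MasterData} {O : CircuitObfuscator} {P : PuncturablePRFScheme}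
    (h : GenAdmissible D O P) : CircCorrect D.params P :=
  fun n K x => h.2.2.2.2.2.2.1 (D.t n) K x

/-- **`RefAdmissible D Γ₁ O`** — the definitional side conditions on a REFERENCE presentation `Γ₁` (intended: a
padded obfuscation of the neighbour circuit by one fixed reference obfuscator, coins derived from the key): code
length polynomial in `ℓ + |K|`; at every level in `ppolyCircuits (ς ℓ)`, of the same size and the same function as
the shipped presentation; eventually in `n` the obfuscator's coin demand on it fits in the seed after the keys.
No hardness content. [folklore] -/
def RefAdmissible (D : MasterData) (Γ₁ : D.Presentation) (O : CircuitObfuscator) : Prop :=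
  (∃ q : Polynomial ℕ, ∀ ℓ K, (encodeSizedCircuit ⟨_, Γ₁ ℓ K⟩).length ≤ q.eval (ℓ + K.length)) ∧
  (∀ ℓ K, (⟨_, Γ₁ ℓ K⟩ : SizedCircuit) ∈ ppolyCircuits (D.ς ℓ) ∧
      (D.Γ ℓ K).size = (Γ₁ ℓ K).size ∧ ∀ x, (D.Γ ℓ K).eval x = (Γ₁ ℓ K).eval x) ∧
  (∃ n₀ : ℕ, ∀ n, n₀ ≤ n → ∀ K : List Bool, K.length = 4 * D.t n →
      O.coins (D.ς (D.t n)) (Γ₁ (D.t n) K) + 4 * D.t n ≤ n)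

/-- **`ReferenceHardness D O P`** — the crux's residual content in its weakest (existential) typed form
(Disproof T-d/T-d′: the reference obfuscation can only be typed existentially): SOME admissible reference
presentation of the neighbour circuits satisfies, IN THE CLEAR and in the evaluating walk model, the
knowledge-of-walk axiom KWA₀ (`KnowledgeOfWalk`, conjecture-grade) and white-box path-finding hardness
WordHard₀ (`WordHard`, crux-grade, advantage-neutral). A hypothesis of the route, never a fact. [folklore] -/
def ReferenceHardness (D : MasterData) (O : CircuitObfuscator) (P : PuncturablePRFScheme) : Prop :=
  ∃ Γ₁ : D.Presentation, RefAdmissible D Γ₁ O ∧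
    KnowledgeOfWalk evalModel (D.lineData Γ₁ P).gen₀ ∧
    WordHard evalModel (D.lineData Γ₁ P).gen₀ (D.lineData Γ₁ P).answer

/-- Registered helper stub of crux stmt-QuantumAdvantage-2340 (`ledger workitem stub-add`; the gate admits a
`--supports` file only if it proves a registered stub): the line datum's walk model is the evaluating model.
[folklore] -/
theorem toolkit_genVocabulary :
    ∀ (D : MasterData) (Γ₁ : D.Presentation) (P : PuncturablePRFScheme), (D.lineData Γ₁ P).M = evalModel :=
  fun _ _ _ => rfl

end Summit.QuantumAdvantage.QuantumAdvantage.Theorems.WbwObfuscatedGluedTrees.KnowledgeOfWalk.Generator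

end
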